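import Summits.BirchSwinnertonDyer.Rank1Residual.Supersingular.RankOneKimLevel27TamDefectRecordsX7_01
import Summits.BirchSwinnertonDyer.Rank1Residual.Supersingular.KuriharaTwistCertsK27TamDefectR1_01
import Summits.BirchSwinnertonDyer.Rank1Residual.Supersingular.RankOneKimLevel27TamDefectRecordsX8_01
import Summits.BirchSwinnertonDyer.Rank1Residual.Supersingular.KuriharaTwistRecordLevelKPrimeLevel
import HarnessLib

/-!
# Rank ONE at `p = 3` — STANDARD-CURRENCY twins (depth-3 (`q = 27`)), part 01: `bsdp_x?r1kim…L_<label>` = my landed Kim-PRE record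
# `bsdp_x?r1kim…_<label>` with the datum `hδ` replaced by the landed depth-3 record + rounding certificate + the engine's ENCLOSURE `hballL`
# (8 records: 2150p1, 2150r1, 3140d1, 4510l1, 4732d1, 5260b1, 7310k1, 8092e1)

Cell `b2b-bsdres`, supersingular family, prover B = unit `b2b-bsdres-additive-p3` (gen 25; X7 joint pair B side; class lead N6·O3) — the
depth-3 sequel of prover A's level-9 precedent `RankOneKimLevel9LValueRecords{A,B}` (x10b gen 13).  Topic file; namespace
`Summit.BirchSwinnertonDyer.Rank1Residual.Supersingular`.  THEOREMS ONLY: each is ONE `exact` onto my landed record theorem with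
`hδ :=` prover A's `kuriharaNumber_primeLevel_ne_zero_of_ainvs_of_certifiedK_of_LValueBall` (`KuriharaTwistRecordLevelKPrimeLevel.lean`;
= `CertifiedK.kuriharaNumber_ne_zero_of_LValueBall` read off the literal equation) applied to this gen's `certK27_*` + `certRK27_*` rows
(implementation 3d depth-3, prover A's engine UNCHANGED, kit j157244, j157251); the good-reduction / depth-3 Kolyvagin / irreducibility side conditions
re-derived in the kernel (point counts by `countPointsFast` / prover A's order certificates, gen-21 surj certificates).  No definition, no named
fact, nothing booked; X7 / X8 stay CONSTRUCTION-SHAPED; the records stay CONDITIONAL on Kim 2025 (OPEN) and, for the TAM-DEFECT family, on the typed `≥` half of Kim's Conj. 1.10 at the pair (`hGe`).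

HONEST FRAMING (run/shared/lean/b2b/bsd-rank1-residual/, verbatim in every file): the goal of the
cell is to DELETE the COMBINATION-SHAPED residual classes of the Birch–Swinnerton-Dyer formula for
ALL analytic-rank `≤ 1` elliptic curves over `ℚ` — "full BSD formula for every rank `≤ 1` curve in
class `C`" assembled STRICTLY from published theorems — so that the rank-`≤ 1` remainder becomes
exactly the CONSTRUCTION-SHAPED classes, which are TYPED (missing-input `Prop`s), NOT attempted.
This is not "finishing BSD".  EVERY theorem here is CONDITIONAL on the ANNOUNCED preprint C.-H. Kim
(app. R. Pollack), arXiv:2505.09121 Thm. 1.1 (`hK25s`, OPEN binder) — a typed OPEN hypothesis, never a theorem.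

References: [Kim2025RefinedTNC] Thm. 1.1 (ANNOUNCED, OPEN); [Kim2022StructureSelmer] §1.2.2, §1.4.3, Conj. 1.10; [MazurTateTeitelbaum1986Invent] §I.8;
[CremonaAlgorithms1997] §2.8; [Cremona2006] Table 1; cell table class-closure/O3/KIM-STD-additive-p3-g25.md.
-/

set_option autoImplicit false

noncomputable section

open scoped Classical MatrixGroups ModularForm

open CongruenceSubgroup WeierstrassCurve Literature.NumberTheory.EllipticCurves
  Literature.NumberTheory.EllipticCurves.ModularForms
  Literature.NumberTheory.EllipticCurves.Rank1Residual
  Literature.NumberTheory.EllipticCurves.Rank1Residual.Typed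
  Literature.NumberTheory.EllipticCurves.Rank1Residual.X11RankOneCertificates
  Literature.NumberTheory.EllipticCurves.Wuthrich2014
  Summit.BirchSwinnertonDyer.BirchSwinnertonDyer.Rank1Residual.IntModel
  Summit.BirchSwinnertonDyer.BirchSwinnertonDyer.Rank1Residual.X11RankOne
  Summit.BirchSwinnertonDyer.Rank1Residual.X11b
  Summit.BirchSwinnertonDyer.Rank1Residual.Additive
  Summit.BirchSwinnertonDyer.Rank1Residual.Supersingular.KuriharaTwist

namespace Summit.BirchSwinnertonDyer.Rank1Residual.Supersingular

/-- **`BSD(E,3)` for `2150p1`, STANDARD CURRENCY** (O4@3 cell = X7@3 ∧ `r_an = 1`, `N = 2150`; `#Ш_an` a `3`-unit, `t = ord₃ ∏c_ℓ = 2` (TAM-DEFECT, depth `k = t + 1 = 3`)): exactly my record `bsdp_x7r1kim27td_2150p1` (`RankOneKimLevel27TamDefectRecordsX7_01.lean`) with its DATUM binder `hδ : kuriharaNumber D.f 27 1621 ψ ≠ 0` DISCHARGED IN THE KERNEL from the landed depth-3 record `certK27_X7r1_2150p1` + the rounding row `certRK27_X7r1_2150p1` (`KuriharaTwistCertsK27TamDefectR1_01`,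 this gen) + the engine's ENCLOSURE `hballL` of `D'·c_∞·re(0·L(E,1) + Σ_{j≠0} e_27(−jk)·τ(χ_j)·L_j(1))/(27·Ω⁺_f)` for the 27 bins (`D' = 2`, `c_∞ = 1`, margin ≤ 475·10^-23, radius ≤ 269·10^-15; prover A's implementation 3d at depth 3, UNCHANGED, kit j157251, `m₀ = 561331`; δ̃ mod 27 = 18 = 18 of engine K v1.3) via prover A's `kuriharaNumber_primeLevel_ne_zero_of_ainvs_of_certifiedK_of_LValueBall` (rounding + algebra = kernel steps); good reduction at 3, `ℓ ∈ 𝒫_3` (point count `#Ẽ(𝔽_ℓ) = 1620`) and irreducibility (`surj_x7r1_2150p1_3`) re-derived in the kernel. BINDERS LEFT: the record's binders minus `hδ` plus `hballL` (`hK25s` Kim 2025 OPEN; `hGe` = Kim Conj. 1.10 `≥` half at the pair (typed, open), `ht`; `hCT`/`hGZK`/`hmod` published; `r_an = 1`, `D`, surjective `ψ`, `#Ш_an` datum). Per pair; nothing booked; X7 / X8 stay CONSTRUCTION-SHAPED. [claim: Kim2025RefinedTNC, status: under-review] [cite: Kim2025RefinedTNC, Thm. 1.1 (ANNOUNCED,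 OPEN binder)] [cite: Kim2022StructureSelmer, §1.2.2 and §1.4.3 (PDF p. 7)] [cite: MazurTateTeitelbaum1986Invent, §I.8 (8.6)] [cite: Cremona2006, Table 1 (Cremona label 2150p1)] -/
theorem bsdp_x7r1kim27tdL_2150p1
    (hK25s : Kim2025.thm11_kimShaLength_of_integralPeriod_OPEN)
    (hCT : exists_casselsTate_pairing (K := ℚ))
    (hGZK : rank_eq_analyticRank_of_analyticRank_le_one) (hmod : hasEntireLFunction_rat)
    (W : WeierstrassCurve ℚ) (hW : W = ⟨1, -1, 1, 20, 47⟩) (hr : W.analyticRank = 1)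
    {N : ℕ} [NeZero N] (D : ModularParametrizationData W N)
    (hGe : ∀ [W.IsGloballyMinimal], X4.KimTamagawaDefectGeAt W 3 D.f)
    (ht : padicValNat 3 W.tamagawaProduct = 2)
    (ψ : (ℓ'' : ℕ) → (ZMod ℓ'')ˣ →* Multiplicative (ZMod (3 ^ 3))) (hψ : Function.Surjective (ψ 1621))
    (hballL : ∀ (L : ZMod (3 ^ 3) → ℂ → ℂ), (∀ j, j ≠ 0 → Differentiable ℂ (L j)) →
      (∀ j, j ≠ 0 → ∀ s : ℂ, 2 < s.re → L j s = twistedLSeries D.f (binChar 1621 ψ j)⁻¹ s) →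
      ∀ k < 3 ^ 3, ∃ mid rad : ℝ, rad ≤ ((269 : ℕ) : ℝ) / 10 ^ (15 : ℕ) ∧
        |mid - (([-26, -42, -22, 0, 22, 42, 26, 12, 32, 32, 18, 0, -44, -50, -10, -8, -10, 10, 8, 10, 50, 44, 0, -18, -32, -32, -12].getD k 0 : ℤ) : ℝ)| ≤ ((475 : ℕ) : ℝ) / 10 ^ (23 : ℕ) ∧
        |((2 : ℕ) : ℝ) * (((1 : ℕ) : ℝ) *
          ((((0 : ℤ) : ℂ) * W.entireLFunction 1 +
            ∑ j ∈ (Finset.univ : Finset (ZMod (3 ^ 3))).erase 0,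
              ZMod.stdAddChar (-(j * (k : ZMod (3 ^ 3)))) *
                (gaussSum (binChar 1621 ψ j) (ZMod.stdAddChar (N := 1621)) * L j 1)).re /
            (((3 ^ 3 : ℕ) : ℝ) * plusPeriod D.f))) - mid| ≤ rad)
    {q : ℚ} (hq : shaAn W = (q : ℂ)) (hv : padicValRat 3 q = 0) : BSDp W 3 := by
  subst hW
  haveI : Fact (Nat.Prime 3) := ⟨by norm_num⟩
  haveI : Fact (Nat.Prime 1621) := ⟨by norm_num⟩
  haveI : NeZero (1621 : ℕ) := ⟨by decide⟩
  exact bsdp_x7r1kim27td_2150p1 (hK25s := hK25s) (hCT := hCT) (hGZK := hGZK) (hmod := hmod) (W := ⟨1, -1, 1, 20, 47⟩) (hW := rfl) (hr := hr)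
    (D := D) (ψ := ψ) (hψ := hψ) (hq := hq) (hv := hv) (hGe := @hGe) (ht := ht)
    (hδ := kuriharaNumber_primeLevel_ne_zero_of_ainvs_of_certifiedK_of_LValueBall 1 (-1) 1 20 47
      (isGloballyMinimal_of_krausCriterion_bounded 1 (-1) 1 20 47
      (by decide +kernel) (by decide +kernel) (by decide +kernel))
      certK27_X7r1_2150p1 (List.Mem.head _) (by decide) (by decide)
      certRK27_X7r1_2150p1 (List.Mem.head _) rfl rfl rfl rfl (by decide)
      (by decide) (np := 4) (countPoints_eq_of_fast (by decide +kernel)) (by decide)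
      surj_x7r1_2150p1_3
      1621 rfl (by norm_num) (by norm_num) (by decide) (by decide) (nl := 1620)
      (countPoints_eq_of_fast (by decide +kernel)) (by decide) (A := 0) (by decide) D ψ hψ hballL)

/-- **`BSD(E,3)` for `2150r1`, STANDARD CURRENCY** (O3 cell = X8@3 ∧ `r_an = 1`, `N = 2150`; `#Ш_an` a `3`-unit, `t = ord₃ ∏c_ℓ = 2` (TAM-DEFECT, depth `k = t + 1 = 3`)): exactly my record `bsdp_x8r1kim27td_2150r1` (`RankOneKimLevel27TamDefectRecordsX8_01.lean`) with its DATUM binder `hδ : kuriharaNumber D.f 27 3457 ψ ≠ 0` DISCHARGED IN THE KERNEL from the landed depth-3 record `certK27_X8r1_2150r1` + the rounding row `certRK27_X8r1_2150r1` (`KuriharaTwistCertsK27TamDefectR1_01`, this gen) + the engine's ENCLOSURE `hballL` of `D'·c_∞·re(27·L(E,1) + Σ_{j≠0} e_27(−jk)·τ(χ_j)·L_j(1))/(27·Ω⁺_f)` for the 27 bins (`D' = 2`, `c_∞ = 1`, margin ≤ 218·10^-22, radius ≤ 122·10^-14; prover A's implementation 3d at depth 3, UNCHANGED, kit j157251,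 `m₀ = 1216434`; δ̃ mod 27 = 18 = 18 of engine K v1.3) via prover A's `kuriharaNumber_primeLevel_ne_zero_of_ainvs_of_certifiedK_of_LValueBall` (rounding + algebra = kernel steps); good reduction at 3, `ℓ ∈ 𝒫_3` (point count `#Ẽ(𝔽_ℓ) = 3429`) and irreducibility (`surj_x8r1_2150r1_3`) re-derived in the kernel. BINDERS LEFT: the record's binders minus `hδ` plus `hballL` (`hK25s` Kim 2025 OPEN; `hGe` = Kim Conj. 1.10 `≥` half at the pair (typed, open), `ht`; `hCT`/`hGZK`/`hmod` published; `r_an = 1`, `D`, surjective `ψ`, `#Ш_an` datum). Per pair; nothing booked; X7 / X8 stay CONSTRUCTION-SHAPED. [claim: Kim2025RefinedTNC, status: under-review] [cite: Kim2025RefinedTNC, Thm. 1.1 (ANNOUNCED, OPEN binder)] [cite: Kim2022StructureSelmer, §1.2.2 and §1.4.3 (PDF p. 7)] [cite: MazurTateTeitelbaum1986Invent, §I.8 (8.6)] [cite: Cremona2006, Table 1 (Cremona label 2150r1)] -/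
theorem bsdp_x8r1kim27tdL_2150r1
    (hK25s : Kim2025.thm11_kimShaLength_of_integralPeriod_OPEN)
    (hCT : exists_casselsTate_pairing (K := ℚ))
    (hGZK : rank_eq_analyticRank_of_analyticRank_le_one) (hmod : hasEntireLFunction_rat)
    (W : WeierstrassCurve ℚ) (hW : W = ⟨1, -1, 1, -303930, 64568697⟩) (hr : W.analyticRank = 1)
    {N : ℕ} [NeZero N] (D : ModularParametrizationData W N)
    (hGe : ∀ [W.IsGloballyMinimal], X4.KimTamagawaDefectGeAt W 3 D.f)
    (ht : padicValNat 3 W.tamagawaProduct = 2)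
    (ψ : (ℓ'' : ℕ) → (ZMod ℓ'')ˣ →* Multiplicative (ZMod (3 ^ 3))) (hψ : Function.Surjective (ψ 3457))
    (hballL : ∀ (L : ZMod (3 ^ 3) → ℂ → ℂ), (∀ j, j ≠ 0 → Differentiable ℂ (L j)) →
      (∀ j, j ≠ 0 → ∀ s : ℂ, 2 < s.re → L j s = twistedLSeries D.f (binChar 3457 ψ j)⁻¹ s) →
      ∀ k < 3 ^ 3, ∃ mid rad : ℝ, rad ≤ ((122 : ℕ) : ℝ) / 10 ^ (14 : ℕ) ∧
        |mid - (([4, 18, 14, -14, 88, -50, -32, 128, 10, -86, 0, 86, -10, -128, 32, 50, -88, 14, -14, -18, -4, -60, 112, 18, -18, -112, 60].getD k 0 : ℤ) : ℝ)| ≤ ((218 : ℕ) : ℝ) / 10 ^ (22 : ℕ) ∧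
        |((2 : ℕ) : ℝ) * (((1 : ℕ) : ℝ) *
          ((((27 : ℤ) : ℂ) * W.entireLFunction 1 +
            ∑ j ∈ (Finset.univ : Finset (ZMod (3 ^ 3))).erase 0,
              ZMod.stdAddChar (-(j * (k : ZMod (3 ^ 3)))) *
                (gaussSum (binChar 3457 ψ j) (ZMod.stdAddChar (N := 3457)) * L j 1)).re /
            (((3 ^ 3 : ℕ) : ℝ) * plusPeriod D.f))) - mid| ≤ rad)
    {q : ℚ} (hq : shaAn W = (q : ℂ)) (hv : padicValRat 3 q = 0) : BSDp W 3 := by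
  subst hW
  haveI : Fact (Nat.Prime 3) := ⟨by norm_num⟩
  haveI : Fact (Nat.Prime 3457) := ⟨by norm_num⟩
  haveI : NeZero (3457 : ℕ) := ⟨by decide⟩
  exact bsdp_x8r1kim27td_2150r1 (hK25s := hK25s) (hCT := hCT) (hGZK := hGZK) (hmod := hmod) (W := ⟨1, -1, 1, -303930, 64568697⟩) (hW := rfl) (hr := hr)
    (D := D) (ψ := ψ) (hψ := hψ) (hq := hq) (hv := hv) (hGe := @hGe) (ht := ht)
    (hδ := kuriharaNumber_primeLevel_ne_zero_of_ainvs_of_certifiedK_of_LValueBall 1 (-1) 1 (-303930) 64568697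
      (isGloballyMinimal_of_krausCriterion_bounded 1 (-1) 1 (-303930) 64568697
      (by decide +kernel) (by decide +kernel) (by decide +kernel))
      certK27_X8r1_2150r1 (List.Mem.head _) (by decide) (by decide)
      certRK27_X8r1_2150r1 (List.Mem.head _) rfl rfl rfl rfl (by decide)
      (by decide) (np := 7) (countPoints_eq_of_fast (by decide +kernel)) (by decide)
      surj_x8r1_2150r1_3
      3457 rfl (by norm_num) (by norm_num) (by decide) (by decide) (nl := 3429)
      (countPoints_eq_of_fast (by decide +kernel)) (by decide) (A := 27) (by decide) D ψ hψ hballL)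

/-- **`BSD(E,3)` for `3140d1`, STANDARD CURRENCY** (O4@3 cell = X7@3 ∧ `r_an = 1`, `N = 3140`; `#Ш_an` a `3`-unit, `t = ord₃ ∏c_ℓ = 2` (TAM-DEFECT, depth `k = t + 1 = 3`)): exactly my record `bsdp_x7r1kim27td_3140d1` (`RankOneKimLevel27TamDefectRecordsX7_01.lean`) with its DATUM binder `hδ : kuriharaNumber D.f 27 379 ψ ≠ 0` DISCHARGED IN THE KERNEL from the landed depth-3 record `certK27_X7r1_3140d1` + the rounding row `certRK27_X7r1_3140d1` (`KuriharaTwistCertsK27TamDefectR1_01`, this gen) + the engine's ENCLOSURE `hballL` of `D'·c_∞·re(0·L(E,1) + Σ_{j≠0} e_27(−jk)·τ(χ_j)·L_j(1))/(27·Ω⁺_f)` for the 27 bins (`D' = 2`, `c_∞ = 2`, margin ≤ 143·10^-22, radius ≤ 188·10^-15; prover A's implementation 3d at depth 3, UNCHANGED, kit j157251, `m₀ = 154336`; δ̃ mod 27 = 9 = 9 of engine K v1.3) via prover A's `kuriharaNumber_primeLevel_ne_zero_of_ainvs_of_certifiedK_of_LValueBall` (rounding + algebra = kernel steps); good reduction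 at 3, `ℓ ∈ 𝒫_3` (point count `#Ẽ(𝔽_ℓ) = 378`) and irreducibility (`surj_x7r1_3140d1_3`) re-derived in the kernel. BINDERS LEFT: the record's binders minus `hδ` plus `hballL` (`hK25s` Kim 2025 OPEN; `hGe` = Kim Conj. 1.10 `≥` half at the pair (typed, open), `ht`; `hCT`/`hGZK`/`hmod` published; `r_an = 1`, `D`, surjective `ψ`, `#Ш_an` datum). Per pair; nothing booked; X7 / X8 stay CONSTRUCTION-SHAPED. [claim: Kim2025RefinedTNC, status: under-review] [cite: Kim2025RefinedTNC, Thm. 1.1 (ANNOUNCED, OPEN binder)] [cite: Kim2022StructureSelmer, §1.2.2 and §1.4.3 (PDF p. 7)] [cite: MazurTateTeitelbaum1986Invent, §I.8 (8.6)] [cite: Cremona2006, Table 1 (Cremona label 3140d1)] -/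
theorem bsdp_x7r1kim27tdL_3140d1
    (hK25s : Kim2025.thm11_kimShaLength_of_integralPeriod_OPEN)
    (hCT : exists_casselsTate_pairing (K := ℚ))
    (hGZK : rank_eq_analyticRank_of_analyticRank_le_one) (hmod : hasEntireLFunction_rat)
    (W : WeierstrassCurve ℚ) (hW : W = ⟨0, 0, 0, -17, 1⟩) (hr : W.analyticRank = 1)
    {N : ℕ} [NeZero N] (D : ModularParametrizationData W N)
    (hGe : ∀ [W.IsGloballyMinimal], X4.KimTamagawaDefectGeAt W 3 D.f)
    (ht : padicValNat 3 W.tamagawaProduct = 2)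
    (ψ : (ℓ'' : ℕ) → (ZMod ℓ'')ˣ →* Multiplicative (ZMod (3 ^ 3))) (hψ : Function.Surjective (ψ 379))
    (hballL : ∀ (L : ZMod (3 ^ 3) → ℂ → ℂ), (∀ j, j ≠ 0 → Differentiable ℂ (L j)) →
      (∀ j, j ≠ 0 → ∀ s : ℂ, 2 < s.re → L j s = twistedLSeries D.f (binChar 379 ψ j)⁻¹ s) →
      ∀ k < 3 ^ 3, ∃ mid rad : ℝ, rad ≤ ((188 : ℕ) : ℝ) / 10 ^ (15 : ℕ) ∧
        |mid - (([-4, -8, 4, -12, 20, 16, -8, 4, -12, 20, -20, 12, -4, 8, -16, -20, 12, -4, 8, 4, -4, -8, 8, 0, -8, 8, 4].getD k 0 : ℤ) : ℝ)| ≤ ((143 : ℕ) : ℝ) / 10 ^ (22 : ℕ) ∧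
        |((2 : ℕ) : ℝ) * (((2 : ℕ) : ℝ) *
          ((((0 : ℤ) : ℂ) * W.entireLFunction 1 +
            ∑ j ∈ (Finset.univ : Finset (ZMod (3 ^ 3))).erase 0,
              ZMod.stdAddChar (-(j * (k : ZMod (3 ^ 3)))) *
                (gaussSum (binChar 379 ψ j) (ZMod.stdAddChar (N := 379)) * L j 1)).re /
            (((3 ^ 3 : ℕ) : ℝ) * plusPeriod D.f))) - mid| ≤ rad)
    {q : ℚ} (hq : shaAn W = (q : ℂ)) (hv : padicValRat 3 q = 0) : BSDp W 3 := by
  subst hW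
  haveI : Fact (Nat.Prime 3) := ⟨by norm_num⟩
  haveI : Fact (Nat.Prime 379) := ⟨by norm_num⟩
  haveI : NeZero (379 : ℕ) := ⟨by decide⟩
  exact bsdp_x7r1kim27td_3140d1 (hK25s := hK25s) (hCT := hCT) (hGZK := hGZK) (hmod := hmod) (W := ⟨0, 0, 0, -17, 1⟩) (hW := rfl) (hr := hr)
    (D := D) (ψ := ψ) (hψ := hψ) (hq := hq) (hv := hv) (hGe := @hGe) (ht := ht)
    (hδ := kuriharaNumber_primeLevel_ne_zero_of_ainvs_of_certifiedK_of_LValueBall 0 0 0 (-17) 1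
      (isGloballyMinimal_of_krausCriterion_bounded 0 0 0 (-17) 1
      (by decide +kernel) (by decide +kernel) (by decide +kernel))
      certK27_X7r1_3140d1 (List.Mem.head _) (by decide) (by decide)
      certRK27_X7r1_3140d1 (List.Mem.head _) rfl rfl rfl rfl (by decide)
      (by decide) (np := 4) (countPoints_eq_of_fast (by decide +kernel)) (by decide)
      surj_x7r1_3140d1_3
      379 rfl (by norm_num) (by norm_num) (by decide) (by decide) (nl := 378)
      (countPoints_eq_of_fast (by decide +kernel)) (by decide) (A := 0) (by decide) D ψ hψ hballL)

/-- **`BSD(E,3)` for `4510l1`, STANDARD CURRENCY** (O3 cell = X8@3 ∧ `r_an = 1`, `N = 4510`; `#Ш_an` a `3`-unit, `t = ord₃ ∏c_ℓ = 2` (TAM-DEFECT, depth `k = t + 1 = 3`)): exactly my record `bsdp_x8r1kim27td_4510l1` (`RankOneKimLevel27TamDefectRecordsX8_01.lean`) with its DATUM binder `hδ : kuriharaNumber D.f 27 109 ψ ≠ 0` DISCHARGED IN THE KERNEL from the landed depth-3 record `certK27_X8r1_4510l1` + the rounding row `certRK27_X8r1_4510l1` (`KuriharaTwistCertsK27TamDefectR1_01`,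 this gen) + the engine's ENCLOSURE `hballL` of `D'·c_∞·re(0·L(E,1) + Σ_{j≠0} e_27(−jk)·τ(χ_j)·L_j(1))/(27·Ω⁺_f)` for the 27 bins (`D' = 2`, `c_∞ = 1`, margin ≤ 906·10^-22, radius ≤ 142·10^-15; prover A's implementation 3d at depth 3, UNCHANGED, kit j157244, `m₀ = 51956`; δ̃ mod 27 = 18 = 18 of engine K v1.3) via prover A's `kuriharaNumber_primeLevel_ne_zero_of_ainvs_of_certifiedK_of_LValueBall` (rounding + algebra = kernel steps); good reduction at 3, `ℓ ∈ 𝒫_3` (point count `#Ẽ(𝔽_ℓ) = 108`) and irreducibility (`surj_x8r1_4510l1_3`) re-derived in the kernel. BINDERS LEFT: the record's binders minus `hδ` plus `hballL` (`hK25s` Kim 2025 OPEN; `hGe` = Kim Conj. 1.10 `≥` half at the pair (typed, open), `ht`; `hCT`/`hGZK`/`hmod` published; `r_an = 1`, `D`, surjective `ψ`, `#Ш_an` datum). Per pair; nothing booked; X7 / X8 stay CONSTRUCTION-SHAPED. [claim: Kim2025RefinedTNC, status: under-review] [cite: Kim2025RefinedTNC, Thm. 1.1 (ANNOUNCED, OPEN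 binder)] [cite: Kim2022StructureSelmer, §1.2.2 and §1.4.3 (PDF p. 7)] [cite: MazurTateTeitelbaum1986Invent, §I.8 (8.6)] [cite: Cremona2006, Table 1 (Cremona label 4510l1)] -/
theorem bsdp_x8r1kim27tdL_4510l1
    (hK25s : Kim2025.thm11_kimShaLength_of_integralPeriod_OPEN)
    (hCT : exists_casselsTate_pairing (K := ℚ))
    (hGZK : rank_eq_analyticRank_of_analyticRank_le_one) (hmod : hasEntireLFunction_rat)
    (W : WeierstrassCurve ℚ) (hW : W = ⟨1, -1, 1, 18, -459⟩) (hr : W.analyticRank = 1)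
    {N : ℕ} [NeZero N] (D : ModularParametrizationData W N)
    (hGe : ∀ [W.IsGloballyMinimal], X4.KimTamagawaDefectGeAt W 3 D.f)
    (ht : padicValNat 3 W.tamagawaProduct = 2)
    (ψ : (ℓ'' : ℕ) → (ZMod ℓ'')ˣ →* Multiplicative (ZMod (3 ^ 3))) (hψ : Function.Surjective (ψ 109))
    (hballL : ∀ (L : ZMod (3 ^ 3) → ℂ → ℂ), (∀ j, j ≠ 0 → Differentiable ℂ (L j)) →
      (∀ j, j ≠ 0 → ∀ s : ℂ, 2 < s.re → L j s = twistedLSeries D.f (binChar 109 ψ j)⁻¹ s) →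
      ∀ k < 3 ^ 3, ∃ mid rad : ℝ, rad ≤ ((142 : ℕ) : ℝ) / 10 ^ (15 : ℕ) ∧
        |mid - (([8, -2, -20, 16, 22, -22, -16, 20, 2, -8, -4, -10, 18, 10, -12, -26, 2, 34, 0, -34, -2, 26, 12, -10, -18, 10, 4].getD k 0 : ℤ) : ℝ)| ≤ ((906 : ℕ) : ℝ) / 10 ^ (22 : ℕ) ∧
        |((2 : ℕ) : ℝ) * (((1 : ℕ) : ℝ) *
          ((((0 : ℤ) : ℂ) * W.entireLFunction 1 +
            ∑ j ∈ (Finset.univ : Finset (ZMod (3 ^ 3))).erase 0,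
              ZMod.stdAddChar (-(j * (k : ZMod (3 ^ 3)))) *
                (gaussSum (binChar 109 ψ j) (ZMod.stdAddChar (N := 109)) * L j 1)).re /
            (((3 ^ 3 : ℕ) : ℝ) * plusPeriod D.f))) - mid| ≤ rad)
    {q : ℚ} (hq : shaAn W = (q : ℂ)) (hv : padicValRat 3 q = 0) : BSDp W 3 := by
  subst hW
  haveI : Fact (Nat.Prime 3) := ⟨by norm_num⟩
  haveI : Fact (Nat.Prime 109) := ⟨by norm_num⟩
  haveI : NeZero (109 : ℕ) := ⟨by decide⟩
  exact bsdp_x8r1kim27td_4510l1 (hK25s := hK25s) (hCT := hCT) (hGZK := hGZK) (hmod := hmod) (W := ⟨1, -1, 1, 18, -459⟩) (hW := rfl) (hr := hr)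
    (D := D) (ψ := ψ) (hψ := hψ) (hq := hq) (hv := hv) (hGe := @hGe) (ht := ht)
    (hδ := kuriharaNumber_primeLevel_ne_zero_of_ainvs_of_certifiedK_of_LValueBall 1 (-1) 1 18 (-459)
      (isGloballyMinimal_of_krausCriterion_bounded 1 (-1) 1 18 (-459)
      (by decide +kernel) (by decide +kernel) (by decide +kernel))
      certK27_X8r1_4510l1 (List.Mem.head _) (by decide) (by decide)
      certRK27_X8r1_4510l1 (List.Mem.head _) rfl rfl rfl rfl (by decide)
      (by decide) (np := 7) (countPoints_eq_of_fast (by decide +kernel)) (by decide)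
      surj_x8r1_4510l1_3
      109 rfl (by norm_num) (by norm_num) (by decide) (by decide) (nl := 108)
      (countPoints_eq_of_fast (by decide +kernel)) (by decide) (A := 0) (by decide) D ψ hψ hballL)

/-- **`BSD(E,3)` for `4732d1`, STANDARD CURRENCY** (O4@3 cell = X7@3 ∧ `r_an = 1`, `N = 4732`; `#Ш_an` a `3`-unit, `t = ord₃ ∏c_ℓ = 2` (TAM-DEFECT, depth `k = t + 1 = 3`)): exactly my record `bsdp_x7r1kim27td_4732d1` (`RankOneKimLevel27TamDefectRecordsX7_01.lean`) with its DATUM binder `hδ : kuriharaNumber D.f 27 2971 ψ ≠ 0` DISCHARGED IN THE KERNEL from the landed depth-3 record `certK27_X7r1_4732d1` + the rounding row `certRK27_X7r1_4732d1` (`KuriharaTwistCertsK27TamDefectR1_01`, this gen) + the engine's ENCLOSURE `hballL` of `D'·c_∞·re(0·L(E,1) + Σ_{j≠0} e_27(−jk)·τ(χ_j)·L_j(1))/(27·Ω⁺_f)` for the 27 bins (`D' = 2`, `c_∞ = 1`, margin ≤ 227·10^-23, radius ≤ 502·10^-15; prover A's implementation 3d at depth 3, UNCHANGED, kit j157251,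 `m₀ = 1558841`; δ̃ mod 27 = 9 = 9 of engine K v1.3) via prover A's `kuriharaNumber_primeLevel_ne_zero_of_ainvs_of_certifiedK_of_LValueBall` (rounding + algebra = kernel steps); good reduction at 3, `ℓ ∈ 𝒫_3` (point count `#Ẽ(𝔽_ℓ) = 2970`) and irreducibility (`surj_x7r1_4732d1_3`) re-derived in the kernel. BINDERS LEFT: the record's binders minus `hδ` plus `hballL` (`hK25s` Kim 2025 OPEN; `hGe` = Kim Conj. 1.10 `≥` half at the pair (typed, open), `ht`; `hCT`/`hGZK`/`hmod` published; `r_an = 1`, `D`, surjective `ψ`, `#Ш_an` datum). Per pair; nothing booked; X7 / X8 stay CONSTRUCTION-SHAPED. [claim: Kim2025RefinedTNC, status: under-review] [cite: Kim2025RefinedTNC, Thm. 1.1 (ANNOUNCED, OPEN binder)] [cite: Kim2022StructureSelmer, §1.2.2 and §1.4.3 (PDF p. 7)] [cite: MazurTateTeitelbaum1986Invent, §I.8 (8.6)] [cite: Cremona2006, Table 1 (Cremona label 4732d1)] -/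
theorem bsdp_x7r1kim27tdL_4732d1
    (hK25s : Kim2025.thm11_kimShaLength_of_integralPeriod_OPEN)
    (hCT : exists_casselsTate_pairing (K := ℚ))
    (hGZK : rank_eq_analyticRank_of_analyticRank_le_one) (hmod : hasEntireLFunction_rat)
    (W : WeierstrassCurve ℚ) (hW : W = ⟨0, 0, 0, -2327, 43342⟩) (hr : W.analyticRank = 1)
    {N : ℕ} [NeZero N] (D : ModularParametrizationData W N)
    (hGe : ∀ [W.IsGloballyMinimal], X4.KimTamagawaDefectGeAt W 3 D.f)
    (ht : padicValNat 3 W.tamagawaProduct = 2)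
    (ψ : (ℓ'' : ℕ) → (ZMod ℓ'')ˣ →* Multiplicative (ZMod (3 ^ 3))) (hψ : Function.Surjective (ψ 2971))
    (hballL : ∀ (L : ZMod (3 ^ 3) → ℂ → ℂ), (∀ j, j ≠ 0 → Differentiable ℂ (L j)) →
      (∀ j, j ≠ 0 → ∀ s : ℂ, 2 < s.re → L j s = twistedLSeries D.f (binChar 2971 ψ j)⁻¹ s) →
      ∀ k < 3 ^ 3, ∃ mid rad : ℝ, rad ≤ ((502 : ℕ) : ℝ) / 10 ^ (15 : ℕ) ∧
        |mid - (([12, 30, 42, -48, -60, -12, 42, 0, 12, -24, 24, -12, 0, -42, 12, 60, 48, -42, -30, -12, 6, 6, -18, 0, 18, -6, -6].getD k 0 : ℤ) : ℝ)| ≤ ((227 : ℕ) : ℝ) / 10 ^ (23 : ℕ) ∧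
        |((2 : ℕ) : ℝ) * (((1 : ℕ) : ℝ) *
          ((((0 : ℤ) : ℂ) * W.entireLFunction 1 +
            ∑ j ∈ (Finset.univ : Finset (ZMod (3 ^ 3))).erase 0,
              ZMod.stdAddChar (-(j * (k : ZMod (3 ^ 3)))) *
                (gaussSum (binChar 2971 ψ j) (ZMod.stdAddChar (N := 2971)) * L j 1)).re /
            (((3 ^ 3 : ℕ) : ℝ) * plusPeriod D.f))) - mid| ≤ rad)
    {q : ℚ} (hq : shaAn W = (q : ℂ)) (hv : padicValRat 3 q = 0) : BSDp W 3 := by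
  subst hW
  haveI : Fact (Nat.Prime 3) := ⟨by norm_num⟩
  haveI : Fact (Nat.Prime 2971) := ⟨by norm_num⟩
  haveI : NeZero (2971 : ℕ) := ⟨by decide⟩
  exact bsdp_x7r1kim27td_4732d1 (hK25s := hK25s) (hCT := hCT) (hGZK := hGZK) (hmod := hmod) (W := ⟨0, 0, 0, -2327, 43342⟩) (hW := rfl) (hr := hr)
    (D := D) (ψ := ψ) (hψ := hψ) (hq := hq) (hv := hv) (hGe := @hGe) (ht := ht)
    (hδ := kuriharaNumber_primeLevel_ne_zero_of_ainvs_of_certifiedK_of_LValueBall 0 0 0 (-2327) 43342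
      (isGloballyMinimal_of_krausCriterion_bounded 0 0 0 (-2327) 43342
      (by decide +kernel) (by decide +kernel) (by decide +kernel))
      certK27_X7r1_4732d1 (List.Mem.head _) (by decide) (by decide)
      certRK27_X7r1_4732d1 (List.Mem.head _) rfl rfl rfl rfl (by decide)
      (by decide) (np := 4) (countPoints_eq_of_fast (by decide +kernel)) (by decide)
      surj_x7r1_4732d1_3
      2971 rfl (by norm_num) (by norm_num) (by decide) (by decide) (nl := 2970)
      (countPoints_eq_of_fast (by decide +kernel)) (by decide) (A := 0) (by decide) D ψ hψ hballL)

/-- **`BSD(E,3)` for `5260b1`, STANDARD CURRENCY** (O4@3 cell = X7@3 ∧ `r_an = 1`, `N = 5260`; `#Ш_an` a `3`-unit, `t = ord₃ ∏c_ℓ = 2` (TAM-DEFECT, depth `k = t + 1 = 3`)): exactly my record `bsdp_x7r1kim27td_5260b1` (`RankOneKimLevel27TamDefectRecordsX7_01.lean`) with its DATUM binder `hδ : kuriharaNumber D.f 27 433 ψ ≠ 0` DISCHARGED IN THE KERNEL from the landed depth-3 record `certK27_X7r1_5260b1` + the rounding row `certRK27_X7r1_5260b1` (`KuriharaTwistCertsK27TamDefectR1_01`,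 this gen) + the engine's ENCLOSURE `hballL` of `D'·c_∞·re(0·L(E,1) + Σ_{j≠0} e_27(−jk)·τ(χ_j)·L_j(1))/(27·Ω⁺_f)` for the 27 bins (`D' = 2`, `c_∞ = 1`, margin ≤ 103·10^-22, radius ≤ 273·10^-15; prover A's implementation 3d at depth 3, UNCHANGED, kit j157244, `m₀ = 230169`; δ̃ mod 27 = 18 = 18 of engine K v1.3) via prover A's `kuriharaNumber_primeLevel_ne_zero_of_ainvs_of_certifiedK_of_LValueBall` (rounding + algebra = kernel steps); good reduction at 3, `ℓ ∈ 𝒫_3` (point count `#Ẽ(𝔽_ℓ) = 432`) and irreducibility (`surj_x7r1_5260b1_3`) re-derived in the kernel. BINDERS LEFT: the record's binders minus `hδ` plus `hballL` (`hK25s` Kim 2025 OPEN; `hGe` = Kim Conj. 1.10 `≥` half at the pair (typed, open), `ht`; `hCT`/`hGZK`/`hmod` published; `r_an = 1`, `D`, surjective `ψ`, `#Ш_an` datum). Per pair; nothing booked; X7 / X8 stay CONSTRUCTION-SHAPED. [claim: Kim2025RefinedTNC, status: under-review] [cite: Kim2025RefinedTNC, Thm. 1.1 (ANNOUNCED, OPEN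 binder)] [cite: Kim2022StructureSelmer, §1.2.2 and §1.4.3 (PDF p. 7)] [cite: MazurTateTeitelbaum1986Invent, §I.8 (8.6)] [cite: Cremona2006, Table 1 (Cremona label 5260b1)] -/
theorem bsdp_x7r1kim27tdL_5260b1
    (hK25s : Kim2025.thm11_kimShaLength_of_integralPeriod_OPEN)
    (hCT : exists_casselsTate_pairing (K := ℚ))
    (hGZK : rank_eq_analyticRank_of_analyticRank_le_one) (hmod : hasEntireLFunction_rat)
    (W : WeierstrassCurve ℚ) (hW : W = ⟨0, 0, 0, -32, -156⟩) (hr : W.analyticRank = 1)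
    {N : ℕ} [NeZero N] (D : ModularParametrizationData W N)
    (hGe : ∀ [W.IsGloballyMinimal], X4.KimTamagawaDefectGeAt W 3 D.f)
    (ht : padicValNat 3 W.tamagawaProduct = 2)
    (ψ : (ℓ'' : ℕ) → (ZMod ℓ'')ˣ →* Multiplicative (ZMod (3 ^ 3))) (hψ : Function.Surjective (ψ 433))
    (hballL : ∀ (L : ZMod (3 ^ 3) → ℂ → ℂ), (∀ j, j ≠ 0 → Differentiable ℂ (L j)) →
      (∀ j, j ≠ 0 → ∀ s : ℂ, 2 < s.re → L j s = twistedLSeries D.f (binChar 433 ψ j)⁻¹ s) →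
      ∀ k < 3 ^ 3, ∃ mid rad : ℝ, rad ≤ ((273 : ℕ) : ℝ) / 10 ^ (15 : ℕ) ∧
        |mid - (([-30, 10, -22, -4, -22, -40, 18, 12, -4, 0, 4, -12, -18, 40, 22, 4, 22, -10, 30, 28, 0, -18, 32, -32, 18, 0, -28].getD k 0 : ℤ) : ℝ)| ≤ ((103 : ℕ) : ℝ) / 10 ^ (22 : ℕ) ∧
        |((2 : ℕ) : ℝ) * (((1 : ℕ) : ℝ) *
          ((((0 : ℤ) : ℂ) * W.entireLFunction 1 +
            ∑ j ∈ (Finset.univ : Finset (ZMod (3 ^ 3))).erase 0,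
              ZMod.stdAddChar (-(j * (k : ZMod (3 ^ 3)))) *
                (gaussSum (binChar 433 ψ j) (ZMod.stdAddChar (N := 433)) * L j 1)).re /
            (((3 ^ 3 : ℕ) : ℝ) * plusPeriod D.f))) - mid| ≤ rad)
    {q : ℚ} (hq : shaAn W = (q : ℂ)) (hv : padicValRat 3 q = 0) : BSDp W 3 := by
  subst hW
  haveI : Fact (Nat.Prime 3) := ⟨by norm_num⟩
  haveI : Fact (Nat.Prime 433) := ⟨by norm_num⟩
  haveI : NeZero (433 : ℕ) := ⟨by decide⟩
  exact bsdp_x7r1kim27td_5260b1 (hK25s := hK25s) (hCT := hCT) (hGZK := hGZK) (hmod := hmod) (W := ⟨0, 0, 0, -32, -156⟩) (hW := rfl) (hr := hr)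
    (D := D) (ψ := ψ) (hψ := hψ) (hq := hq) (hv := hv) (hGe := @hGe) (ht := ht)
    (hδ := kuriharaNumber_primeLevel_ne_zero_of_ainvs_of_certifiedK_of_LValueBall 0 0 0 (-32) (-156)
      (isGloballyMinimal_of_krausCriterion_bounded 0 0 0 (-32) (-156)
      (by decide +kernel) (by decide +kernel) (by decide +kernel))
      certK27_X7r1_5260b1 (List.Mem.head _) (by decide) (by decide)
      certRK27_X7r1_5260b1 (List.Mem.head _) rfl rfl rfl rfl (by decide)
      (by decide) (np := 4) (countPoints_eq_of_fast (by decide +kernel)) (by decide)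
      surj_x7r1_5260b1_3
      433 rfl (by norm_num) (by norm_num) (by decide) (by decide) (nl := 432)
      (countPoints_eq_of_fast (by decide +kernel)) (by decide) (A := 0) (by decide) D ψ hψ hballL)

/-- **`BSD(E,3)` for `7310k1`, STANDARD CURRENCY** (O3 cell = X8@3 ∧ `r_an = 1`, `N = 7310`; `#Ш_an` a `3`-unit, `t = ord₃ ∏c_ℓ = 2` (TAM-DEFECT, depth `k = t + 1 = 3`)): exactly my record `bsdp_x8r1kim27td_7310k1` (`RankOneKimLevel27TamDefectRecordsX8_01.lean`) with its DATUM binder `hδ : kuriharaNumber D.f 27 271 ψ ≠ 0` DISCHARGED IN THE KERNEL from the landed depth-3 record `certK27_X8r1_7310k1` + the rounding row `certRK27_X8r1_7310k1` (`KuriharaTwistCertsK27TamDefectR1_01`, this gen) + the engine's ENCLOSURE `hballL` of `D'·c_∞·re(0·L(E,1) + Σ_{j≠0} e_27(−jk)·τ(χ_j)·L_j(1))/(27·Ω⁺_f)` for the 27 bins (`D' = 2`, `c_∞ = 1`, margin ≤ 425·10^-22, radius ≤ 351·10^-15; prover A's implementation 3d at depth 3, UNCHANGED, kit j157244, `m₀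 = 168701`; δ̃ mod 27 = 9 = 9 of engine K v1.3) via prover A's `kuriharaNumber_primeLevel_ne_zero_of_ainvs_of_certifiedK_of_LValueBall` (rounding + algebra = kernel steps); good reduction at 3, `ℓ ∈ 𝒫_3` (point count `#Ẽ(𝔽_ℓ) = 270`) and irreducibility (`surj_x8r1_7310k1_3`) re-derived in the kernel. BINDERS LEFT: the record's binders minus `hδ` plus `hballL` (`hK25s` Kim 2025 OPEN; `hGe` = Kim Conj. 1.10 `≥` half at the pair (typed, open), `ht`; `hCT`/`hGZK`/`hmod` published; `r_an = 1`, `D`, surjective `ψ`, `#Ш_an` datum). Per pair; nothing booked; X7 / X8 stay CONSTRUCTION-SHAPED. [claim: Kim2025RefinedTNC, status: under-review] [cite: Kim2025RefinedTNC, Thm. 1.1 (ANNOUNCED, OPEN binder)] [cite: Kim2022StructureSelmer, §1.2.2 and §1.4.3 (PDF p. 7)] [cite: MazurTateTeitelbaum1986Invent, §I.8 (8.6)] [cite: Cremona2006, Table 1 (Cremona label 7310k1)] -/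
theorem bsdp_x8r1kim27tdL_7310k1
    (hK25s : Kim2025.thm11_kimShaLength_of_integralPeriod_OPEN)
    (hCT : exists_casselsTate_pairing (K := ℚ))
    (hGZK : rank_eq_analyticRank_of_analyticRank_le_one) (hmod : hasEntireLFunction_rat)
    (W : WeierstrassCurve ℚ) (hW : W = ⟨1, -1, 1, 1512, 3267⟩) (hr : W.analyticRank = 1)
    {N : ℕ} [NeZero N] (D : ModularParametrizationData W N)
    (hGe : ∀ [W.IsGloballyMinimal], X4.KimTamagawaDefectGeAt W 3 D.f)
    (ht : padicValNat 3 W.tamagawaProduct = 2)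
    (ψ : (ℓ'' : ℕ) → (ZMod ℓ'')ˣ →* Multiplicative (ZMod (3 ^ 3))) (hψ : Function.Surjective (ψ 271))
    (hballL : ∀ (L : ZMod (3 ^ 3) → ℂ → ℂ), (∀ j, j ≠ 0 → Differentiable ℂ (L j)) →
      (∀ j, j ≠ 0 → ∀ s : ℂ, 2 < s.re → L j s = twistedLSeries D.f (binChar 271 ψ j)⁻¹ s) →
      ∀ k < 3 ^ 3, ∃ mid rad : ℝ, rad ≤ ((351 : ℕ) : ℝ) / 10 ^ (15 : ℕ) ∧
        |mid - (([-32, 28, -4, -64, 14, 46, 0, -26, -74, 36, 0, -36, 74, 26, 0, -46, -14, 64, 4, -28, 32, -12, -30, -46, 46, 30, 12].getD k 0 : ℤ) : ℝ)| ≤ ((425 : ℕ) : ℝ) / 10 ^ (22 : ℕ) ∧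
        |((2 : ℕ) : ℝ) * (((1 : ℕ) : ℝ) *
          ((((0 : ℤ) : ℂ) * W.entireLFunction 1 +
            ∑ j ∈ (Finset.univ : Finset (ZMod (3 ^ 3))).erase 0,
              ZMod.stdAddChar (-(j * (k : ZMod (3 ^ 3)))) *
                (gaussSum (binChar 271 ψ j) (ZMod.stdAddChar (N := 271)) * L j 1)).re /
            (((3 ^ 3 : ℕ) : ℝ) * plusPeriod D.f))) - mid| ≤ rad)
    {q : ℚ} (hq : shaAn W = (q : ℂ)) (hv : padicValRat 3 q = 0) : BSDp W 3 := by
  subst hW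
  haveI : Fact (Nat.Prime 3) := ⟨by norm_num⟩
  haveI : Fact (Nat.Prime 271) := ⟨by norm_num⟩
  haveI : NeZero (271 : ℕ) := ⟨by decide⟩
  exact bsdp_x8r1kim27td_7310k1 (hK25s := hK25s) (hCT := hCT) (hGZK := hGZK) (hmod := hmod) (W := ⟨1, -1, 1, 1512, 3267⟩) (hW := rfl) (hr := hr)
    (D := D) (ψ := ψ) (hψ := hψ) (hq := hq) (hv := hv) (hGe := @hGe) (ht := ht)
    (hδ := kuriharaNumber_primeLevel_ne_zero_of_ainvs_of_certifiedK_of_LValueBall 1 (-1) 1 1512 3267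
      (isGloballyMinimal_of_krausCriterion_bounded 1 (-1) 1 1512 3267
      (by decide +kernel) (by decide +kernel) (by decide +kernel))
      certK27_X8r1_7310k1 (List.Mem.head _) (by decide) (by decide)
      certRK27_X8r1_7310k1 (List.Mem.head _) rfl rfl rfl rfl (by decide)
      (by decide) (np := 7) (countPoints_eq_of_fast (by decide +kernel)) (by decide)
      surj_x8r1_7310k1_3
      271 rfl (by norm_num) (by norm_num) (by decide) (by decide) (nl := 270)
      (countPoints_eq_of_fast (by decide +kernel)) (by decide) (A := 0) (by decide) D ψ hψ hballL)

/-- **`BSD(E,3)` for `8092e1`, STANDARD CURRENCY** (O4@3 cell = X7@3 ∧ `r_an = 1`, `N = 8092`; `#Ш_an` a `3`-unit, `t = ord₃ ∏c_ℓ = 2` (TAM-DEFECT, depth `k = t + 1 = 3`)): exactly my record `bsdp_x7r1kim27td_8092e1` (`RankOneKimLevel27TamDefectRecordsX7_01.lean`) with its DATUM binder `hδ : kuriharaNumber D.f 27 919 ψ ≠ 0` DISCHARGED IN THE KERNEL from the landed depth-3 record `certK27_X7r1_8092e1` + the rounding row `certRK27_X7r1_8092e1` (`KuriharaTwistCertsK27TamDefectR1_01`,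 this gen) + the engine's ENCLOSURE `hballL` of `D'·c_∞·re(-27·L(E,1) + Σ_{j≠0} e_27(−jk)·τ(χ_j)·L_j(1))/(27·Ω⁺_f)` for the 27 bins (`D' = 2`, `c_∞ = 1`, margin ≤ 324·10^-22, radius ≤ 958·10^-15; prover A's implementation 3d at depth 3, UNCHANGED, kit j157244, `m₀ = 618644`; δ̃ mod 27 = 18 = 18 of engine K v1.3) via prover A's `kuriharaNumber_primeLevel_ne_zero_of_ainvs_of_certifiedK_of_LValueBall` (rounding + algebra = kernel steps); good reduction at 3, `ℓ ∈ 𝒫_3` (point count `#Ẽ(𝔽_ℓ) = 945`) and irreducibility (`surj_x7r1_8092e1_3`) re-derived in the kernel. BINDERS LEFT: the record's binders minus `hδ` plus `hballL` (`hK25s` Kim 2025 OPEN; `hGe` = Kim Conj. 1.10 `≥` half at the pair (typed, open), `ht`; `hCT`/`hGZK`/`hmod` published; `r_an = 1`, `D`, surjective `ψ`, `#Ш_an` datum). Per pair; nothing booked; X7 / X8 stay CONSTRUCTION-SHAPED. [claim: Kim2025RefinedTNC, status: under-review] [cite: Kim2025RefinedTNC, Thm. 1.1 (ANNOUNCED,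 OPEN binder)] [cite: Kim2022StructureSelmer, §1.2.2 and §1.4.3 (PDF p. 7)] [cite: MazurTateTeitelbaum1986Invent, §I.8 (8.6)] [cite: Cremona2006, Table 1 (Cremona label 8092e1)] -/
theorem bsdp_x7r1kim27tdL_8092e1
    (hK25s : Kim2025.thm11_kimShaLength_of_integralPeriod_OPEN)
    (hCT : exists_casselsTate_pairing (K := ℚ))
    (hGZK : rank_eq_analyticRank_of_analyticRank_le_one) (hmod : hasEntireLFunction_rat)
    (W : WeierstrassCurve ℚ) (hW : W = ⟨0, 0, 0, -4913, 2088025⟩) (hr : W.analyticRank = 1)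
    {N : ℕ} [NeZero N] (D : ModularParametrizationData W N)
    (hGe : ∀ [W.IsGloballyMinimal], X4.KimTamagawaDefectGeAt W 3 D.f)
    (ht : padicValNat 3 W.tamagawaProduct = 2)
    (ψ : (ℓ'' : ℕ) → (ZMod ℓ'')ˣ →* Multiplicative (ZMod (3 ^ 3))) (hψ : Function.Surjective (ψ 919))
    (hballL : ∀ (L : ZMod (3 ^ 3) → ℂ → ℂ), (∀ j, j ≠ 0 → Differentiable ℂ (L j)) →
      (∀ j, j ≠ 0 → ∀ s : ℂ, 2 < s.re → L j s = twistedLSeries D.f (binChar 919 ψ j)⁻¹ s) →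
      ∀ k < 3 ^ 3, ∃ mid rad : ℝ, rad ≤ ((958 : ℕ) : ℝ) / 10 ^ (15 : ℕ) ∧
        |mid - (([-94, 108, -44, -50, 0, 50, 44, -108, 94, -32, 90, -150, 182, -120, 140, -142, 210, -172, 172, -210, 142, -140, 120, -182, 150, -90, 32].getD k 0 : ℤ) : ℝ)| ≤ ((324 : ℕ) : ℝ) / 10 ^ (22 : ℕ) ∧
        |((2 : ℕ) : ℝ) * (((1 : ℕ) : ℝ) *
          ((((-27 : ℤ) : ℂ) * W.entireLFunction 1 +
            ∑ j ∈ (Finset.univ : Finset (ZMod (3 ^ 3))).erase 0,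
              ZMod.stdAddChar (-(j * (k : ZMod (3 ^ 3)))) *
                (gaussSum (binChar 919 ψ j) (ZMod.stdAddChar (N := 919)) * L j 1)).re /
            (((3 ^ 3 : ℕ) : ℝ) * plusPeriod D.f))) - mid| ≤ rad)
    {q : ℚ} (hq : shaAn W = (q : ℂ)) (hv : padicValRat 3 q = 0) : BSDp W 3 := by
  subst hW
  haveI : Fact (Nat.Prime 3) := ⟨by norm_num⟩
  haveI : Fact (Nat.Prime 919) := ⟨by norm_num⟩
  haveI : NeZero (919 : ℕ) := ⟨by decide⟩
  exact bsdp_x7r1kim27td_8092e1 (hK25s := hK25s) (hCT := hCT) (hGZK := hGZK) (hmod := hmod) (W := ⟨0, 0, 0, -4913, 2088025⟩) (hW := rfl) (hr := hr)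
    (D := D) (ψ := ψ) (hψ := hψ) (hq := hq) (hv := hv) (hGe := @hGe) (ht := ht)
    (hδ := kuriharaNumber_primeLevel_ne_zero_of_ainvs_of_certifiedK_of_LValueBall 0 0 0 (-4913) 2088025
      (isGloballyMinimal_of_krausCriterion_bounded 0 0 0 (-4913) 2088025
      (by decide +kernel) (by decide +kernel) (by decide +kernel))
      certK27_X7r1_8092e1 (List.Mem.head _) (by decide) (by decide)
      certRK27_X7r1_8092e1 (List.Mem.head _) rfl rfl rfl rfl (by decide)
      (by decide) (np := 4) (countPoints_eq_of_fast (by decide +kernel)) (by decide)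
      surj_x7r1_8092e1_3
      919 rfl (by norm_num) (by norm_num) (by decide) (by decide) (nl := 945)
      (countPoints_eq_of_fast (by decide +kernel)) (by decide) (A := -27) (by decide) D ψ hψ hballL)

end Summit.BirchSwinnertonDyer.Rank1Residual.Supersingular

end
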